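import Mathlib
import Literature.MathematicalPhysics.QuantumFieldTheory.Balaban1983to89.Beta.VectorTailsPt
import Literature.MathematicalPhysics.QuantumFieldTheory.Balaban1983to89.Beta.LongitudinalWindow

/-!
# (W3a)₀ vector road, node VECTOR-TAILS-PROP12 — the LONGITUDINAL HALF of the wall's
# free-comparison rows: `𝒢 = ⊕_μ Γ_μ + 𝓛` read per base point, the window rows of `𝓛`
# (`C₀/n²`, `C₁/n³`, `2C₁/n³`, `C₂/n⁴`, constants depending on `(d = 4, a)` only), the
# block-translation covariance of BOTH halves, and the reduction of the torus-side rows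
# `h0T / h1T / h1×T / h2×T` for `𝒢` to the same rows for the `Γ`-part

HONEST FRAMING (verbatim, binding for this lineage).  «discharging `BetaPertH` makes Bałaban's UV
stability UNCONDITIONAL — a real constructive-QFT result; it is NOT the continuum limit and NOT the
Clay problem.»  ABSOLUTE RULE (verbatim).  «No internally-minted statement may enter as a cited
fact. Every hypothesis is either kernel-proved in this package or a verbatim quotation of a
PUBLISHED theorem with page reference. The manuscript(s) under audit are NOT citable for their own
disputed steps — they are the thing under adjudication; programme-internal (2001/route/tribunal)
claims are never citable.»  THIS MODULE IS KERNEL MATHEMATICS ONLY: it cites nothing, asserts no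
`Prop`-valued published fact, consumes `Beta.LongitudinalWindow` (K0)/(K1)/(K1′)/(K2) and
`Beta.VectorPropagatorDict` (D6) BY NAME, and every statement below is proved.  Every docstring is
tagged `[folklore]` (bookkeeping / linear algebra on finite tori); zero cited facts.

## What this file is for (the located gap)

The average-first scalar wall `Beta.SquareTableAvgFirst.oneLoopDrift_of_scalarBounds_avgFirst`
takes, besides the DECAY rows `d0 / d1 / d1× / d2×` (supplied for the entries of `𝒢 = Δ_a⁻¹`
modulo [B5, (1.110)–(1.114), (1.126)–(1.127)] BY NAME by `Beta.VectorTailsPt.wall_rows_mod` and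
its cyclic-block instance `Beta.VectorTailsBlock.rows_block`), four FREE-COMPARISON rows
`h0 / h1 / h1× / h2×`: `|G_n(b; v) − G_free(v)| ≤ D₀/n²`, one lattice difference `≤ D₁/n³`, the
cross-base-point difference `≤ D₃/n³`, the cross mixed second difference `≤ D₂/n⁴`, FOR ALL `v`
(the window).  Their torus side (an4 `Beta.WallVolumeTransfer` §`Avg`, binders `h0T / h1T / h1×T /
h2×T`, torus free leg `gT`) is, for the vector road, a statement about the entries of `𝒢`.  By the
dictionary row (D6) `Beta.VectorPropagatorDict.calG_eq_gammaSum_add_longitudinal`,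
`𝒢 = ⊕_μ Γ_μ + U^*𝓛̂U` EXACTLY, with `Γ_μ` the scalar (P0₀)-decomposed kernels of the bond-averaged
weights and `𝓛` the rank-one-per-fibre longitudinal term of line 3 of [B5, (1.83)], whose kernel
`Beta.LongitudinalWindow.Lker` obeys the volume-uniform window bounds (K0) `|𝓛| ≤ C₀(d,a)/n^d`,
(K1)/(K1′) `|∇𝓛|, |∇′𝓛| ≤ C₁(d,a)/n^{d+1}`, (K2) `|∇∇′𝓛| ≤ C₂(d,a)/n^{d+2}` — kernel theorems of
the tree.  This module turns them into the wall's binder shapes: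

* §1 (any `d`) GENERIC BLOCK-TRANSLATION COVARIANCE at `U = 1`: for EVERY fibrewise block family
  `B(p′)`, the conjugated block operator `U^*(⊕_{p′}B(p′))U` commutes with the block translations
  `S_ν^n` (the phase of `n e_ν` is constant on the cosets `p = p′ + l`; this generalises
  `Beta.VectorTailsPt.shiftM_pow_mul_calG`, same proof), hence its entries are invariant under
  simultaneous translation of both sites by the block lattice `blockSteps n M`; corollaries
  `gammaSum_translate` and `Lker_translate` — BOTH halves of `𝒢 = ⊕Γ + 𝓛` are block-covariant,
  not only their sum.
* §2 (`d = 4`) THE SPLIT OF THE READING: `rd = rdS + rdL` and, in the literal binder shape of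
  `Beta.VectorTailsPt.GT`, `GT = GS + LT` (`GS n b t v = n² φ((⊕Γ)((X₀ b + v, kk b), (X₀ b, nn b)))`,
  `LT n b t v = n² φ(𝓛(X₀ b + v, kk b; X₀ b, nn b))`); `GS = 0` off the diagonal `kk b ≠ nn b`.
* §3 THE LONGITUDINAL ROWS, POINTWISE IN THE VOLUME (no filter, no box; every `n ≥ 1`, `b`, `t`,
  `v ∈ ℤ⁴`): `|LT| ≤ ellD0 4 a/n²`; `|LT(v + e_ρ) − LT(v)| ≤ ellD1 4 a/n³`; under the WRAPPED-SHIFT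
  hypotheses of `wall_rows_mod` (`X₀ (sh b) − (X₀ b + e_μ) ∈ blockSteps`, `kk`, `nn` invariant) the
  cross rows `|LT(sh b; v) − LT(b; v)| ≤ 2·ellD1 4 a/n³` and
  `|LT(b; v+e_μ+e_ν) − LT(b; v+e_μ) − (LT(sh b; v+e_ν) − LT(sh b; v))| ≤ ellD2 4 a/n⁴`.
* §4 THE REDUCTION: the torus-side rows `h0T / h1T / h1×T / h2×T` of `Beta.WallVolumeTransfer`
  (§`Avg`, literal binder texts) for `GT` against any torus free leg `gT` FOLLOW from the same four
  rows for the `Γ`-part `GS` against the same `gT` with constants `D_Γ`, the constants becoming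
  `Dvec D_Γ a = (D_Γ 0 + ellD0 4 a, D_Γ 1 + ellD1 4 a, D_Γ 2 + ellD2 4 a, D_Γ 3 + 2·ellD1 4 a)` —
  the triangle inequality.

WHAT THIS FILE DOES NOT DO.  It does not supply the `Γ`-part rows (the scalar kernels
`GdecW (wt (bondAvg κ)) a 0` against the torus free leg: the scalar suppliers' rows — note `GS` is
`δ_{kk b, nn b}`-diagonal, §2), nor the volume limits `hG` of the seam (an4
`Beta.EntrywiseVolumeLimit` / an5), nor any identification with Bałaban's `β̄_k` ((W3b)₀, an2), and
it makes no continuum or Clay claim.  NOT summit progress: a consumer adapter.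
-/

open Finset Matrix Filter Topology
open scoped BigOperators Matrix

namespace Literature.MathematicalPhysics.QuantumFieldTheory.Balaban1983to89.Beta.VectorTailsWindow

open Literature.MathematicalPhysics.QuantumFieldTheory.Balaban1983to89.B5Prop11Plancherel
open Literature.MathematicalPhysics.QuantumFieldTheory.Balaban1983to89.Beta.VectorPropagatorDict
  (gammaSum gammaSum_apply OBlocks calOhat gammaSum_eq_conj LBlocks calLhat
    calG_eq_gammaSum_add_longitudinal)
open Literature.MathematicalPhysics.QuantumFieldTheory.Balaban1983to89.Beta.LongitudinalWindow
  (Lker ellD0 ellD1 ellD2 norm_Lker_le norm_Lker_sub_left_le norm_Lker_sub_right_le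
    norm_Lker_sub_sub_le gammaPlus_pos' legC_nonneg legC2_nonneg)
open Literature.MathematicalPhysics.QuantumFieldTheory.Balaban1983to89.Beta.VectorTails (castT)
open Literature.MathematicalPhysics.QuantumFieldTheory.Balaban1983to89.Beta.VectorTailsPt
  (rdM rd GT GT_pos castT_add_unitVec abs_sq_mul_le shiftM_pow_mul_apply mul_shiftM_pow_apply
    dftV_mul_shiftM_pow phase_pow_emb blockSteps nsmul_unitVec_mem_blockSteps)

noncomputable section

/-! ## §1 Generic block-translation covariance of conjugated block operators (any dimension) -/

section BlockCov

variable {d : ℕ} (n : ℕ) [NeZero n] (M : Fin d → ℕ) [hM : ∀ μ, NeZero (M μ)]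

/-- the CONJUGATED BLOCK OPERATOR `U^* (⊕_{p′} B(p′)) U` of a fibrewise block family `B` on the
fine torus (`𝒢 = conjBlock blocks`, `⊕Γ = conjBlock OBlocks`, `U^*𝓛̂U = conjBlock LBlocks`).
[folklore] -/
def conjBlock (B : Tor M → Matrix ((Fin d → Fin n) × Fin d) ((Fin d → Fin n) × Fin d) ℂ) :
    Matrix (Tor (fine n M) × Fin d) (Tor (fine n M) × Fin d) ℂ :=
  star (dftV (fine n M))
    * (Matrix.reindex (B5Prop11Plancherel.blockEquiv n M) (B5Prop11Plancherel.blockEquiv n M)).symm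
        (Matrix.blockDiagonal B)
    * dftV (fine n M)

/-- a Fourier multiplier CONSTANT ON THE COSETS `p = p′ + l` commutes with every transported
block-diagonal family. [folklore] -/
theorem diagonal_mul_rblock_comm
    (B : Tor M → Matrix ((Fin d → Fin n) × Fin d) ((Fin d → Fin n) × Fin d) ℂ)
    {g : Tor (fine n M) × Fin d → ℂ} {f : Tor M → ℂ}
    (hg : ∀ I, g (B5Prop11Plancherel.emb n M I) = f I.2) :
    Matrix.diagonal g
        * (Matrix.reindex (B5Prop11Plancherel.blockEquiv n M)
            (B5Prop11Plancherel.blockEquiv n M)).symm (Matrix.blockDiagonal B)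
      = (Matrix.reindex (B5Prop11Plancherel.blockEquiv n M)
            (B5Prop11Plancherel.blockEquiv n M)).symm (Matrix.blockDiagonal B)
        * Matrix.diagonal g := by
  have hP : ∀ P, g P = f (B5Prop11Plancherel.blockEquiv n M P).2 := fun P => by
    conv_lhs =>
      rw [← (B5Prop11Plancherel.blockEquiv n M).symm_apply_apply P,
        B5Prop11Plancherel.blockEquiv_symm_apply]
    exact hg _
  ext P P'
  rw [Matrix.diagonal_mul, Matrix.mul_diagonal, hP P, hP P']
  simp only [Matrix.reindex_symm, Matrix.reindex_apply, Equiv.symm_symm, Matrix.submatrix_apply,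
    Matrix.blockDiagonal_apply]
  split_ifs with h
  · rw [h, mul_comm]
  · simp

/-- **BLOCK TRANSLATIONS COMMUTE WITH EVERY CONJUGATED BLOCK OPERATOR**:
`S_ν^n (U^*(⊕B)U) = (U^*(⊕B)U) S_ν^n`. [folklore] -/
theorem shiftM_pow_mul_conjBlock
    (B : Tor M → Matrix ((Fin d → Fin n) × Fin d) ((Fin d → Fin n) × Fin d) ℂ) (ν : Fin d) :
    shiftM (fine n M) ν ^ n * conjBlock n M B = conjBlock n M B * shiftM (fine n M) ν ^ n := by
  set D : Matrix (Tor (fine n M) × Fin d) (Tor (fine n M) × Fin d) ℂ :=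
    Matrix.diagonal (fun i : Tor (fine n M) × Fin d =>
      (ZMod.stdAddChar (N := fine n M ν)) (i.1 ν) ^ n) with hD
  set R : Matrix (Tor (fine n M) × Fin d) (Tor (fine n M) × Fin d) ℂ :=
    (Matrix.reindex (B5Prop11Plancherel.blockEquiv n M)
      (B5Prop11Plancherel.blockEquiv n M)).symm (Matrix.blockDiagonal B) with hR
  have hF : dftV (fine n M) * shiftM (fine n M) ν ^ n = D * dftV (fine n M) :=
    dftV_mul_shiftM_pow (fine n M) ν n
  have hS : shiftM (fine n M) ν ^ n = star (dftV (fine n M)) * (D * dftV (fine n M)) := by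
    rw [← hF, ← Matrix.mul_assoc, star_dftV_mul, Matrix.one_mul]
  have hDR : D * R = R * D :=
    diagonal_mul_rblock_comm n M B
      (f := fun q : Tor M =>
        (ZMod.stdAddChar (N := fine n M ν)) ((((n : ℤ) * (q ν).valMinAbs : ℤ) : ZMod (fine n M ν))))
      (fun I => phase_pow_emb n M ν I)
  have hc : conjBlock n M B = star (dftV (fine n M)) * R * dftV (fine n M) := rfl
  rw [hS, hc]
  simp only [Matrix.mul_assoc]
  rw [← Matrix.mul_assoc (dftV (fine n M)) (star (dftV (fine n M))), dftV_mul_star,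
    Matrix.one_mul, ← Matrix.mul_assoc (dftV (fine n M)) (star (dftV (fine n M))), dftV_mul_star,
    Matrix.one_mul, ← Matrix.mul_assoc D, hDR, Matrix.mul_assoc]

/-- block-translation covariance of the ENTRIES of a conjugated block operator:
`(U^*(⊕B)U)((x + n e_ν, κ), (y + n e_ν, κ′)) = (U^*(⊕B)U)((x, κ), (y, κ′))`. [folklore] -/
theorem conjBlock_blockShift
    (B : Tor M → Matrix ((Fin d → Fin n) × Fin d) ((Fin d → Fin n) × Fin d) ℂ) (ν : Fin d)
    (x y : Tor (fine n M)) (κ κ' : Fin d) :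
    conjBlock n M B (x + n • unitVec (fine n M) ν, κ) (y + n • unitVec (fine n M) ν, κ')
      = conjBlock n M B (x, κ) (y, κ') := by
  have h := congr_fun (congr_fun (shiftM_pow_mul_conjBlock n M B ν) (x, κ))
    (y + n • unitVec (fine n M) ν, κ')
  rw [shiftM_pow_mul_apply, mul_shiftM_pow_apply] at h
  simpa using h

/-- **the entries of every conjugated block operator are invariant under simultaneous block
translation of both sites** (`T ∈ blockSteps n M = Σ_ν ℤ · n e_ν`). [folklore] -/
theorem conjBlock_translate
    (B : Tor M → Matrix ((Fin d → Fin n) × Fin d) ((Fin d → Fin n) × Fin d) ℂ)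
    {T : Tor (fine n M)} (hT : T ∈ blockSteps n M) (x y : Tor (fine n M)) (κ κ' : Fin d) :
    conjBlock n M B (x + T, κ) (y + T, κ') = conjBlock n M B (x, κ) (y, κ') := by
  induction hT using AddSubgroup.closure_induction generalizing x y with
  | mem T hT =>
    obtain ⟨ν, rfl⟩ := hT
    exact conjBlock_blockShift n M B ν x y κ κ'
  | zero => simp
  | add T₁ T₂ _ _ ih₁ ih₂ => rw [← add_assoc, ← add_assoc, ih₂, ih₁]
  | neg T _ ih =>
    have h := ih (x + -T) (y + -T)
    simp only [neg_add_cancel_right] at h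
    exact h.symm

variable (hn : 1 ≤ n) (a : ℝ) (ha : 0 < a)

/-- `𝒢 = U^* Ĝ U` is the conjugated block operator of `blocks`. [folklore] -/
theorem calG_eq_conjBlock : calG n hn M a ha = conjBlock n M (blocks n hn M a ha) := rfl

/-- `⊕_μ Γ_μ = U^* 𝓞̂ U` is the conjugated block operator of `OBlocks`
(`VectorPropagatorDict.gammaSum_eq_conj`). [folklore] -/
theorem gammaSum_eq_conjBlock : gammaSum n M a = conjBlock n M (OBlocks n hn M a ha) :=
  gammaSum_eq_conj n hn M a ha

/-- `𝓛 = U^* 𝓛̂ U` entrywise is the conjugated block operator of `LBlocks`. [folklore] -/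
theorem Lker_eq_conjBlock (x : Tor (fine n M)) (μ : Fin d) (x' : Tor (fine n M)) (ν : Fin d) :
    Lker n hn M a ha x μ x' ν = conjBlock n M (LBlocks n hn M a ha) (x, μ) (x', ν) := rfl

include hn ha in
/-- **BLOCK-TRANSLATION COVARIANCE OF `⊕_μ Γ_μ`.** [folklore] -/
theorem gammaSum_translate {T : Tor (fine n M)} (hT : T ∈ blockSteps n M) (x y : Tor (fine n M))
    (κ κ' : Fin d) : gammaSum n M a (x + T, κ) (y + T, κ') = gammaSum n M a (x, κ) (y, κ') := by
  rw [gammaSum_eq_conjBlock n M hn a ha]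
  exact conjBlock_translate n M _ hT x y κ κ'

/-- **BLOCK-TRANSLATION COVARIANCE OF THE LONGITUDINAL KERNEL `𝓛`.** [folklore] -/
theorem Lker_translate {T : Tor (fine n M)} (hT : T ∈ blockSteps n M) (x : Tor (fine n M))
    (μ : Fin d) (x' : Tor (fine n M)) (ν : Fin d) :
    Lker n hn M a ha (x + T) μ (x' + T) ν = Lker n hn M a ha x μ x' ν :=
  conjBlock_translate n M (LBlocks n hn M a ha) hT x x' μ ν

end BlockCov

/-! ## §2 The split of the reading: `rd = rdS + rdL`, `GT = GS + LT` -/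

section Reading

variable (n : ℕ) [NeZero n] (hn : 1 ≤ n) (M : Fin 4 → ℕ) [hM : ∀ μ, NeZero (M μ)] (a : ℝ)
  (ha : 0 < a)

/-- THE READING OF THE `Γ`-PART: `rdS n M a x₀ κ ν₀ φ v = n² φ((⊕_μΓ_μ)((x₀ + v, κ), (x₀, ν₀)))`.
[folklore] -/
def rdS : Tor (fine n M) → Fin 4 → Fin 4 → (ℂ →+ ℝ) → DyadicShell.Pt → ℝ :=
  rdM n M (gammaSum n M a)

/-- THE READING OF THE LONGITUDINAL PART: `rdL n hn M a ha x₀ κ ν₀ φ v = n² φ(𝓛(x₀ + v, κ; x₀, ν₀))`.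
[folklore] -/
def rdL : Tor (fine n M) → Fin 4 → Fin 4 → (ℂ →+ ℝ) → DyadicShell.Pt → ℝ :=
  rdM n M (star (dftV (fine n M)) * calLhat n hn M a ha * dftV (fine n M))

/-- `rdL` unfolds to the longitudinal kernel `Lker`. [folklore] -/
theorem rdL_eq (x₀ : Tor (fine n M)) (κ ν₀ : Fin 4) (φ : ℂ →+ ℝ) (v : DyadicShell.Pt) :
    rdL n hn M a ha x₀ κ ν₀ φ v
      = ((n : ℕ) : ℝ) ^ 2 * φ (Lker n hn M a ha (x₀ + castT (fine n M) v) κ x₀ ν₀) := rfl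

/-- `rdS` unfolds to the entries of `⊕_μ Γ_μ`. [folklore] -/
theorem rdS_eq (x₀ : Tor (fine n M)) (κ ν₀ : Fin 4) (φ : ℂ →+ ℝ) (v : DyadicShell.Pt) :
    rdS n M a x₀ κ ν₀ φ v
      = ((n : ℕ) : ℝ) ^ 2 * φ (gammaSum n M a (x₀ + castT (fine n M) v, κ) (x₀, ν₀)) := rfl

/-- **THE SPLIT OF THE READING**: `rd = rdS + rdL` (`𝒢 = ⊕Γ + U^*𝓛̂U`, (D6)). [folklore] -/
theorem rd_eq_rdS_add_rdL (x₀ : Tor (fine n M)) (κ ν₀ : Fin 4) (φ : ℂ →+ ℝ) (v : DyadicShell.Pt) :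
    rd n hn M a ha x₀ κ ν₀ φ v = rdS n M a x₀ κ ν₀ φ v + rdL n hn M a ha x₀ κ ν₀ φ v := by
  simp only [rd, rdS, rdL, rdM]
  rw [calG_eq_gammaSum_add_longitudinal n hn M a ha, Matrix.add_apply, map_add, mul_add]

/-- the `Γ`-part is DIAGONAL IN THE COMPONENTS: `rdS … κ ν₀ … = 0` for `κ ≠ ν₀`. [folklore] -/
theorem rdS_eq_zero_of_ne (x₀ : Tor (fine n M)) {κ ν₀ : Fin 4} (h : κ ≠ ν₀) (φ : ℂ →+ ℝ)
    (v : DyadicShell.Pt) : rdS n M a x₀ κ ν₀ φ v = 0 := by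
  rw [rdS_eq, gammaSum_apply, if_neg h, map_zero, mul_zero]

include hn ha in
/-- the `Γ`-part reading is invariant under block translation of the base point. [folklore] -/
theorem rdS_translate {T : Tor (fine n M)} (hT : T ∈ blockSteps n M) (x₀ : Tor (fine n M))
    (κ ν₀ : Fin 4) (φ : ℂ →+ ℝ) (v : DyadicShell.Pt) :
    rdS n M a (x₀ + T) κ ν₀ φ v = rdS n M a x₀ κ ν₀ φ v := by
  rw [rdS_eq, rdS_eq, add_right_comm, gammaSum_translate n M hn a ha hT]

/-- the longitudinal reading is invariant under block translation of the base point. [folklore] -/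
theorem rdL_translate {T : Tor (fine n M)} (hT : T ∈ blockSteps n M) (x₀ : Tor (fine n M))
    (κ ν₀ : Fin 4) (φ : ℂ →+ ℝ) (v : DyadicShell.Pt) :
    rdL n hn M a ha (x₀ + T) κ ν₀ φ v = rdL n hn M a ha x₀ κ ν₀ φ v := by
  rw [rdL_eq, rdL_eq, add_right_comm, Lker_translate n M hn a ha hT]

/-! ### §3 The longitudinal rows, pointwise (constants `ellD0 4 a`, `ellD1 4 a`, `ellD2 4 a`) -/

omit [NeZero n] in
include hn in
/-- `X ≤ C / n^{q+2}` gives `n² X ≤ C / n^q`. [folklore] -/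
theorem sq_mul_le_of {X C : ℝ} (p q : ℕ) (hpq : p = q + 2) (h : X ≤ C / ((n : ℕ) : ℝ) ^ p) :
    ((n : ℕ) : ℝ) ^ 2 * X ≤ C / ((n : ℕ) : ℝ) ^ q := by
  have hnr : (0 : ℝ) < n := by exact_mod_cast hn
  subst hpq
  calc ((n : ℕ) : ℝ) ^ 2 * X ≤ ((n : ℕ) : ℝ) ^ 2 * (C / ((n : ℕ) : ℝ) ^ (q + 2)) :=
      mul_le_mul_of_nonneg_left h (by positivity)
    _ = C / ((n : ℕ) : ℝ) ^ q := by
      rw [pow_add]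
      field_simp

/-- **(L0) THE LONGITUDINAL READING IS FLAT OF SIZE `n⁻²`**: `|rdL(x₀; κ, ν₀; v)| ≤ ellD0 4 a / n²`
for every base point, component pair and `v ∈ ℤ⁴`, uniformly in the periods ((K0) × `n²`).
[folklore] -/
theorem abs_rdL_le {φ : ℂ →+ ℝ} (hφ : ∀ z, |φ z| ≤ ‖z‖) (x₀ : Tor (fine n M)) (κ ν₀ : Fin 4)
    (v : DyadicShell.Pt) : |rdL n hn M a ha x₀ κ ν₀ φ v| ≤ ellD0 4 a / ((n : ℕ) : ℝ) ^ 2 := by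
  rw [rdL_eq]
  refine (abs_sq_mul_le n hφ _).trans ?_
  have h := norm_Lker_le n hn M a ha (by norm_num : 0 < 4) (x₀ + castT (fine n M) v) κ x₀ ν₀
  exact sq_mul_le_of n hn 4 2 rfl h

/-- **(L1) ONE LATTICE DIFFERENCE IN `v` GAINS `n⁻¹`**:
`|rdL(x₀; v + e_ρ) − rdL(x₀; v)| ≤ ellD1 4 a / n³` ((K1) × `n²`). [folklore] -/
theorem abs_rdL_sub_le {φ : ℂ →+ ℝ} (hφ : ∀ z, |φ z| ≤ ‖z‖) (x₀ : Tor (fine n M)) (κ ν₀ : Fin 4)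
    (v : DyadicShell.Pt) (ρ : Fin 4) :
    |rdL n hn M a ha x₀ κ ν₀ φ (v + BubbleTransfer.unitVec ρ) - rdL n hn M a ha x₀ κ ν₀ φ v|
      ≤ ellD1 4 a / ((n : ℕ) : ℝ) ^ 3 := by
  rw [rdL_eq, rdL_eq, castT_add_unitVec, ← add_assoc, ← mul_sub, ← map_sub]
  refine (abs_sq_mul_le n hφ _).trans ?_
  have h := norm_Lker_sub_left_le n hn M a ha (by norm_num : 0 < 4) ρ (x₀ + castT (fine n M) v)
    κ x₀ ν₀
  exact sq_mul_le_of n hn (4 + 1) 3 rfl h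

/-- **(L1×) THE CROSS-BASE-POINT DIFFERENCE GAINS `n⁻¹`**: if the second base point is the first
translated by `e_μ` MODULO A BLOCK TRANSLATION, then `|rdL(x₀′; v) − rdL(x₀; v)| ≤ 2·ellD1 4 a / n³`
((K1) + (K1′) after `Lker_translate`, × `n²`). [folklore] -/
theorem abs_rdL_cross_le {φ : ℂ →+ ℝ} (hφ : ∀ z, |φ z| ≤ ‖z‖) {x₀ x₀' : Tor (fine n M)} {μ : Fin 4}
    (hx : x₀' - (x₀ + unitVec (fine n M) μ) ∈ blockSteps n M) (κ ν₀ : Fin 4) (v : DyadicShell.Pt) :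
    |rdL n hn M a ha x₀' κ ν₀ φ v - rdL n hn M a ha x₀ κ ν₀ φ v|
      ≤ 2 * ellD1 4 a / ((n : ℕ) : ℝ) ^ 3 := by
  have hx' : x₀' = x₀ + unitVec (fine n M) μ + (x₀' - (x₀ + unitVec (fine n M) μ)) := by abel
  rw [hx', rdL_translate n hn M a ha hx, rdL_eq, rdL_eq, ← mul_sub, ← map_sub]
  refine (abs_sq_mul_le n hφ _).trans ?_
  set y : Tor (fine n M) := x₀ + castT (fine n M) v with hy
  have e1 : x₀ + unitVec (fine n M) μ + castT (fine n M) v = y + unitVec (fine n M) μ := by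
    rw [hy]; abel
  rw [e1]
  have hA := norm_Lker_sub_left_le n hn M a ha (by norm_num : 0 < 4) μ y κ
    (x₀ + unitVec (fine n M) μ) ν₀
  have hB := norm_Lker_sub_right_le n hn M a ha (by norm_num : 0 < 4) μ y κ x₀ ν₀
  have hsplit : Lker n hn M a ha (y + unitVec (fine n M) μ) κ (x₀ + unitVec (fine n M) μ) ν₀
        - Lker n hn M a ha y κ x₀ ν₀
      = (Lker n hn M a ha (y + unitVec (fine n M) μ) κ (x₀ + unitVec (fine n M) μ) ν₀
          - Lker n hn M a ha y κ (x₀ + unitVec (fine n M) μ) ν₀)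
        + (Lker n hn M a ha y κ (x₀ + unitVec (fine n M) μ) ν₀ - Lker n hn M a ha y κ x₀ ν₀) := by
    ring
  have hsum : ‖Lker n hn M a ha (y + unitVec (fine n M) μ) κ (x₀ + unitVec (fine n M) μ) ν₀
        - Lker n hn M a ha y κ x₀ ν₀‖ ≤ 2 * ellD1 4 a / ((n : ℕ) : ℝ) ^ (4 + 1) := by
    rw [hsplit, two_mul, add_div]
    exact (norm_add_le _ _).trans (add_le_add hA hB)
  exact sq_mul_le_of n hn (4 + 1) 3 rfl hsum

/-- **(L2×) THE CROSS MIXED SECOND DIFFERENCE GAINS `n⁻²`**: with `x₀′ ≡ x₀ + e_μ` modulo a block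
translation, `|rdL(x₀; v+e_μ+e_ν) − rdL(x₀; v+e_μ) − (rdL(x₀′; v+e_ν) − rdL(x₀′; v))| ≤ ellD2 4 a / n⁴`
((K2) after `Lker_translate`, × `n²`). [folklore] -/
theorem abs_rdL_mixed_le {φ : ℂ →+ ℝ} (hφ : ∀ z, |φ z| ≤ ‖z‖) {x₀ x₀' : Tor (fine n M)} {μ : Fin 4}
    (hx : x₀' - (x₀ + unitVec (fine n M) μ) ∈ blockSteps n M) (ν κ ν₀ : Fin 4)
    (v : DyadicShell.Pt) :
    |rdL n hn M a ha x₀ κ ν₀ φ (v + BubbleTransfer.unitVec μ + BubbleTransfer.unitVec ν)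
        - rdL n hn M a ha x₀ κ ν₀ φ (v + BubbleTransfer.unitVec μ)
        - (rdL n hn M a ha x₀' κ ν₀ φ (v + BubbleTransfer.unitVec ν) - rdL n hn M a ha x₀' κ ν₀ φ v)|
      ≤ ellD2 4 a / ((n : ℕ) : ℝ) ^ 4 := by
  have hx' : x₀' = x₀ + unitVec (fine n M) μ + (x₀' - (x₀ + unitVec (fine n M) μ)) := by abel
  rw [hx', rdL_translate n hn M a ha hx, rdL_translate n hn M a ha hx]
  simp only [rdL_eq, castT_add_unitVec]
  set y : Tor (fine n M) := x₀ + castT (fine n M) v + unitVec (fine n M) μ with hy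
  have e1 : x₀ + (castT (fine n M) v + unitVec (fine n M) μ + unitVec (fine n M) ν)
      = y + unitVec (fine n M) ν := by rw [hy]; abel
  have e2 : x₀ + (castT (fine n M) v + unitVec (fine n M) μ) = y := by rw [hy]; abel
  have e3 : x₀ + unitVec (fine n M) μ + (castT (fine n M) v + unitVec (fine n M) ν)
      = y + unitVec (fine n M) ν := by rw [hy]; abel
  have e4 : x₀ + unitVec (fine n M) μ + castT (fine n M) v = y := by rw [hy]; abel
  rw [e1, e2, e3, e4]
  have key :
      ((n : ℕ) : ℝ) ^ 2 * φ (Lker n hn M a ha (y + unitVec (fine n M) ν) κ x₀ ν₀)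
        - ((n : ℕ) : ℝ) ^ 2 * φ (Lker n hn M a ha y κ x₀ ν₀)
        - (((n : ℕ) : ℝ) ^ 2 * φ (Lker n hn M a ha (y + unitVec (fine n M) ν) κ
              (x₀ + unitVec (fine n M) μ) ν₀)
            - ((n : ℕ) : ℝ) ^ 2 * φ (Lker n hn M a ha y κ (x₀ + unitVec (fine n M) μ) ν₀))
      = -(((n : ℕ) : ℝ) ^ 2 * φ
          ((Lker n hn M a ha (y + unitVec (fine n M) ν) κ (x₀ + unitVec (fine n M) μ) ν₀
              - Lker n hn M a ha y κ (x₀ + unitVec (fine n M) μ) ν₀)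
            - (Lker n hn M a ha (y + unitVec (fine n M) ν) κ x₀ ν₀
              - Lker n hn M a ha y κ x₀ ν₀))) := by
    simp only [map_sub]
    ring
  rw [key, abs_neg]
  refine (abs_sq_mul_le n hφ _).trans ?_
  have h := norm_Lker_sub_sub_le n hn M a ha (by norm_num : 0 < 4) ν μ y κ x₀ ν₀
  exact sq_mul_le_of n hn (4 + 2) 4 rfl h

end Reading

/-! ### The constants -/

/-- `0 ≤ ellD0 d a`. [folklore] -/
theorem ellD0_nonneg (d : ℕ) {a : ℝ} (ha : 0 < a) : 0 ≤ ellD0 d a := by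
  have hγ := gammaPlus_pos' (d := d) ha
  have hL := legC_nonneg (d := d) ha
  unfold ellD0
  positivity

/-- `0 ≤ ellD1 d a`. [folklore] -/
theorem ellD1_nonneg (d : ℕ) {a : ℝ} (ha : 0 < a) : 0 ≤ ellD1 d a := by
  have hγ := gammaPlus_pos' (d := d) ha
  have hL := legC_nonneg (d := d) ha
  have hL2 := legC2_nonneg (d := d) ha
  unfold ellD1
  positivity

/-- `0 ≤ ellD2 d a`. [folklore] -/
theorem ellD2_nonneg (d : ℕ) {a : ℝ} (ha : 0 < a) : 0 ≤ ellD2 d a := by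
  have hγ := gammaPlus_pos' (d := d) ha
  have hL2 := legC2_nonneg (d := d) ha
  unfold ellD2
  positivity

/-- THE LONGITUDINAL ADDENDS of the four free-comparison constants, indexed as the wall's `D`:
`0 ↦ ellD0 4 a` (h0), `1 ↦ ellD1 4 a` (h1), `2 ↦ ellD2 4 a` (h2×), `3 ↦ 2·ellD1 4 a` (h1×).
[folklore] -/
def lAdd (a : ℝ) : ℕ → ℝ
  | 0 => ellD0 4 a
  | 1 => ellD1 4 a
  | 2 => ellD2 4 a
  | 3 => 2 * ellD1 4 a
  | _ => 0

/-- the longitudinal addends are nonnegative. [folklore] -/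
theorem lAdd_nonneg {a : ℝ} (ha : 0 < a) : ∀ j, 0 ≤ lAdd a j
  | 0 => ellD0_nonneg 4 ha
  | 1 => ellD1_nonneg 4 ha
  | 2 => ellD2_nonneg 4 ha
  | 3 => mul_nonneg zero_le_two (ellD1_nonneg 4 ha)
  | _ + 4 => le_rfl

/-- THE VECTOR ROAD'S FREE-COMPARISON CONSTANTS from the `Γ`-part's: `Dvec D a j = D j + lAdd a j`.
[folklore] -/
def Dvec (D : ℕ → ℝ) (a : ℝ) : ℕ → ℝ := fun j => D j + lAdd a j

/-- `Dvec` preserves nonnegativity. [folklore] -/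
theorem Dvec_nonneg {D : ℕ → ℝ} (hD : ∀ j, 0 ≤ D j) {a : ℝ} (ha : 0 < a) : ∀ j, 0 ≤ Dvec D a j :=
  fun j => add_nonneg (hD j) (lAdd_nonneg ha j)

/-! ## §2′–§3′ The split and the longitudinal rows in the wall's binder shape `GT` -/

section Transport

variable {τ : Type} {κB : Type*} (Mv : ℕ+ × τ → Fin 4 → ℕ) [hMv : ∀ i ρ, NeZero (Mv i ρ)]
  (a : ℝ) (ha : 0 < a)

/-- THE `Γ`-PART OF THE WALL'S TORUS-SIDE FAMILY: `GS n b t v = n² φ((⊕Γ)_{(n,t)}((X₀ b + v, kk b),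
(X₀ b, nn b)))` for `n ≥ 1`, `0` at `n = 0` — the binder shape of `VectorTailsPt.GT`. [folklore] -/
def GS (X₀ : (i : ℕ+ × τ) → κB → Tor (fine ((i.1 : ℕ+) : ℕ) (Mv i))) (kk nn : ℕ → κB → Fin 4)
    (φ : ℂ →+ ℝ) (n : ℕ) (b : κB) (t : τ) (v : DyadicShell.Pt) : ℝ :=
  if h : 0 < n then
    rdS (PNat.val ⟨n, h⟩) (Mv (⟨n, h⟩, t)) a (X₀ (⟨n, h⟩, t) b) (kk n b) (nn n b) φ v
  else 0

/-- THE LONGITUDINAL PART OF THE WALL'S TORUS-SIDE FAMILY: `LT n b t v = n² φ(𝓛_{(n,t)}(X₀ b + v,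
kk b; X₀ b, nn b))` for `n ≥ 1`, `0` at `n = 0`. [folklore] -/
def LT (X₀ : (i : ℕ+ × τ) → κB → Tor (fine ((i.1 : ℕ+) : ℕ) (Mv i))) (kk nn : ℕ → κB → Fin 4)
    (φ : ℂ →+ ℝ) (n : ℕ) (b : κB) (t : τ) (v : DyadicShell.Pt) : ℝ :=
  if h : 0 < n then
    rdL (PNat.val ⟨n, h⟩) (PNat.pos _) (Mv (⟨n, h⟩, t)) a ha (X₀ (⟨n, h⟩, t) b) (kk n b) (nn n b)
      φ v
  else 0

/-- `GS` at a positive scale. [folklore] -/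
theorem GS_pos (X₀ : (i : ℕ+ × τ) → κB → Tor (fine ((i.1 : ℕ+) : ℕ) (Mv i)))
    (kk nn : ℕ → κB → Fin 4) (φ : ℂ →+ ℝ) {n : ℕ} (h : 0 < n) (b : κB) (t : τ)
    (v : DyadicShell.Pt) :
    GS Mv a X₀ kk nn φ n b t v
      = rdS (PNat.val ⟨n, h⟩) (Mv (⟨n, h⟩, t)) a (X₀ (⟨n, h⟩, t) b) (kk n b) (nn n b) φ v :=
  dif_pos h

/-- `LT` at a positive scale. [folklore] -/
theorem LT_pos (X₀ : (i : ℕ+ × τ) → κB → Tor (fine ((i.1 : ℕ+) : ℕ) (Mv i)))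
    (kk nn : ℕ → κB → Fin 4) (φ : ℂ →+ ℝ) {n : ℕ} (h : 0 < n) (b : κB) (t : τ)
    (v : DyadicShell.Pt) :
    LT Mv a ha X₀ kk nn φ n b t v
      = rdL (PNat.val ⟨n, h⟩) (PNat.pos _) (Mv (⟨n, h⟩, t)) a ha (X₀ (⟨n, h⟩, t) b) (kk n b)
          (nn n b) φ v :=
  dif_pos h

/-- **THE SPLIT IN THE WALL'S BINDER SHAPE: `GT = GS + LT`.** [folklore] -/
theorem GT_eq_GS_add_LT (X₀ : (i : ℕ+ × τ) → κB → Tor (fine ((i.1 : ℕ+) : ℕ) (Mv i)))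
    (kk nn : ℕ → κB → Fin 4) (φ : ℂ →+ ℝ) (n : ℕ) (b : κB) (t : τ) (v : DyadicShell.Pt) :
    GT Mv a ha X₀ kk nn φ n b t v = GS Mv a X₀ kk nn φ n b t v + LT Mv a ha X₀ kk nn φ n b t v := by
  by_cases h : 0 < n
  · rw [GT_pos Mv a ha X₀ kk nn φ h, GS_pos Mv a X₀ kk nn φ h, LT_pos Mv a ha X₀ kk nn φ h]
    exact rd_eq_rdS_add_rdL _ _ _ a ha _ _ _ φ v
  · simp [GT, GS, LT, h]

/-- off the component diagonal the `Γ`-part vanishes: `GS n b t v = 0` if `kk n b ≠ nn n b` (there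
the free comparison of `GT` is a statement about `LT` alone). [folklore] -/
theorem GS_eq_zero_of_ne (X₀ : (i : ℕ+ × τ) → κB → Tor (fine ((i.1 : ℕ+) : ℕ) (Mv i)))
    (kk nn : ℕ → κB → Fin 4) (φ : ℂ →+ ℝ) {n : ℕ} {b : κB} (h : kk n b ≠ nn n b) (t : τ)
    (v : DyadicShell.Pt) : GS Mv a X₀ kk nn φ n b t v = 0 := by
  by_cases h0 : 0 < n
  · rw [GS_pos Mv a X₀ kk nn φ h0]
    exact rdS_eq_zero_of_ne _ _ a _ h φ v
  · simp [GS, h0]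

/-- **(L0) IN THE WALL'S SHAPE**: `|LT n b t v| ≤ ellD0 4 a / n²` for all `n ≥ 1`, `b`, `t`, `v`.
[folklore] -/
theorem lt0 (X₀ : (i : ℕ+ × τ) → κB → Tor (fine ((i.1 : ℕ+) : ℕ) (Mv i)))
    (kk nn : ℕ → κB → Fin 4) {φ : ℂ →+ ℝ} (hφ : ∀ z, |φ z| ≤ ‖z‖) {n : ℕ} (hn : 0 < n) (b : κB)
    (t : τ) (v : DyadicShell.Pt) :
    |LT Mv a ha X₀ kk nn φ n b t v| ≤ ellD0 4 a / (n : ℝ) ^ 2 := by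
  rw [LT_pos Mv a ha X₀ kk nn φ hn]
  exact abs_rdL_le _ _ _ a ha hφ _ _ _ v

/-- **(L1) IN THE WALL'S SHAPE**: `|LT n b t (v + e_ρ) − LT n b t v| ≤ ellD1 4 a / n³`. [folklore] -/
theorem lt1 (X₀ : (i : ℕ+ × τ) → κB → Tor (fine ((i.1 : ℕ+) : ℕ) (Mv i)))
    (kk nn : ℕ → κB → Fin 4) {φ : ℂ →+ ℝ} (hφ : ∀ z, |φ z| ≤ ‖z‖) {n : ℕ} (hn : 0 < n) (b : κB)
    (t : τ) (v : DyadicShell.Pt) (ρ : Fin 4) :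
    |LT Mv a ha X₀ kk nn φ n b t (v + BubbleTransfer.unitVec ρ) - LT Mv a ha X₀ kk nn φ n b t v|
      ≤ ellD1 4 a / (n : ℝ) ^ 3 := by
  rw [LT_pos Mv a ha X₀ kk nn φ hn, LT_pos Mv a ha X₀ kk nn φ hn]
  exact abs_rdL_sub_le _ _ _ a ha hφ _ _ _ v ρ

variable (X₀ : (i : ℕ+ × τ) → κB → Tor (fine ((i.1 : ℕ+) : ℕ) (Mv i))) (kk nn : ℕ → κB → Fin 4)
  {φ : ℂ →+ ℝ} (hφ : ∀ z, |φ z| ≤ ‖z‖) (Bset : ℕ → Finset κB) (sh : ℕ → Equiv.Perm κB) {μ ν : Fin 4}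
  (hX : ∀ (m : ℕ+) (t : τ), ∀ b ∈ Bset m,
    X₀ (m, t) (sh m b) - (X₀ (m, t) b + unitVec (fine (m : ℕ) (Mv (m, t))) μ)
      ∈ blockSteps (m : ℕ) (Mv (m, t)))
  (hk : ∀ m : ℕ, ∀ b ∈ Bset m, kk m (sh m b) = kk m b)
  (hν : ∀ m : ℕ, ∀ b ∈ Bset m, nn m (sh m b) = nn m b)

include hφ hX hk hν in
/-- **(L1×) IN THE WALL'S SHAPE**: under the wrapped-shift hypotheses of `wall_rows_mod`,
`|LT n (sh n b) t v − LT n b t v| ≤ 2·ellD1 4 a / n³` on `Bset n`. [folklore] -/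
theorem lt1x {n : ℕ} (hn : 0 < n) {b : κB} (hb : b ∈ Bset n) (t : τ) (v : DyadicShell.Pt) :
    |LT Mv a ha X₀ kk nn φ n (sh n b) t v - LT Mv a ha X₀ kk nn φ n b t v|
      ≤ 2 * ellD1 4 a / (n : ℝ) ^ 3 := by
  rw [LT_pos Mv a ha X₀ kk nn φ hn, LT_pos Mv a ha X₀ kk nn φ hn, hk n b hb, hν n b hb]
  exact abs_rdL_cross_le _ _ _ a ha hφ (hX ⟨n, hn⟩ t b hb) _ _ v

include hφ hX hk hν in
/-- **(L2×) IN THE WALL'S SHAPE**: under the wrapped-shift hypotheses,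
`|LT n b t (v+e_μ+e_ν) − LT n b t (v+e_μ) − (LT n (sh n b) t (v+e_ν) − LT n (sh n b) t v)| ≤ ellD2 4 a / n⁴`
on `Bset n`. [folklore] -/
theorem lt2x {n : ℕ} (hn : 0 < n) {b : κB} (hb : b ∈ Bset n) (t : τ) (v : DyadicShell.Pt) :
    |LT Mv a ha X₀ kk nn φ n b t (v + BubbleTransfer.unitVec μ + BubbleTransfer.unitVec ν)
        - LT Mv a ha X₀ kk nn φ n b t (v + BubbleTransfer.unitVec μ)
        - (LT Mv a ha X₀ kk nn φ n (sh n b) t (v + BubbleTransfer.unitVec ν)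
            - LT Mv a ha X₀ kk nn φ n (sh n b) t v)|
      ≤ ellD2 4 a / (n : ℝ) ^ 4 := by
  simp only [LT_pos Mv a ha X₀ kk nn φ hn, hk n b hb, hν n b hb]
  exact abs_rdL_mixed_le _ _ _ a ha hφ (hX ⟨n, hn⟩ t b hb) ν _ _ v

/-! ## §4 The reduction of the wall's torus-side free-comparison rows to the `Γ`-part -/

variable {l : Filter τ} (gT : ℕ → κB → τ → DyadicShell.Pt → ℝ) (D : ℕ → ℝ)

include hφ in
/-- **`h0T` FOR `𝒢` FROM `h0T` FOR `⊕Γ`** (`WallVolumeTransfer.h0_avg_vol`'s torus binder, any torus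
free leg `gT`): constant `D 0 + ellD0 4 a`. [folklore] -/
theorem h0T_of_gamma
    (h0S : ∀ n : ℕ, 2 ≤ n → ∀ b ∈ Bset n, ∀ v, ∀ᶠ t in l,
      |GS Mv a X₀ kk nn φ n b t v - gT n b t v| ≤ D 0 / (n : ℝ) ^ 2) :
    ∀ n : ℕ, 2 ≤ n → ∀ b ∈ Bset n, ∀ v, ∀ᶠ t in l,
      |GT Mv a ha X₀ kk nn φ n b t v - gT n b t v| ≤ Dvec D a 0 / (n : ℝ) ^ 2 := by
  intro n hn b hb v
  filter_upwards [h0S n hn b hb v] with t ht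
  have h0 : 0 < n := by omega
  have e : GT Mv a ha X₀ kk nn φ n b t v - gT n b t v
      = (GS Mv a X₀ kk nn φ n b t v - gT n b t v) + LT Mv a ha X₀ kk nn φ n b t v := by
    rw [GT_eq_GS_add_LT]; ring
  rw [e, Dvec, lAdd, add_div]
  exact (abs_add_le _ _).trans (add_le_add ht (lt0 Mv a ha X₀ kk nn hφ h0 b t v))

include hφ in
/-- **`h1T` FOR `𝒢` FROM `h1T` FOR `⊕Γ`**: constant `D 1 + ellD1 4 a`. [folklore] -/
theorem h1T_of_gamma
    (h1S : ∀ n : ℕ, 2 ≤ n → ∀ b ∈ Bset n, ∀ v (ρ : Fin 4), ∀ᶠ t in l,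
      |(GS Mv a X₀ kk nn φ n b t (v + BubbleTransfer.unitVec ρ) - gT n b t (v + BubbleTransfer.unitVec ρ))
          - (GS Mv a X₀ kk nn φ n b t v - gT n b t v)| ≤ D 1 / (n : ℝ) ^ 3) :
    ∀ n : ℕ, 2 ≤ n → ∀ b ∈ Bset n, ∀ v (ρ : Fin 4), ∀ᶠ t in l,
      |(GT Mv a ha X₀ kk nn φ n b t (v + BubbleTransfer.unitVec ρ)
            - gT n b t (v + BubbleTransfer.unitVec ρ))
          - (GT Mv a ha X₀ kk nn φ n b t v - gT n b t v)| ≤ Dvec D a 1 / (n : ℝ) ^ 3 := by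
  intro n hn b hb v ρ
  filter_upwards [h1S n hn b hb v ρ] with t ht
  have h0 : 0 < n := by omega
  have e : (GT Mv a ha X₀ kk nn φ n b t (v + BubbleTransfer.unitVec ρ)
            - gT n b t (v + BubbleTransfer.unitVec ρ))
          - (GT Mv a ha X₀ kk nn φ n b t v - gT n b t v)
      = ((GS Mv a X₀ kk nn φ n b t (v + BubbleTransfer.unitVec ρ)
            - gT n b t (v + BubbleTransfer.unitVec ρ))
          - (GS Mv a X₀ kk nn φ n b t v - gT n b t v))
        + (LT Mv a ha X₀ kk nn φ n b t (v + BubbleTransfer.unitVec ρ)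
            - LT Mv a ha X₀ kk nn φ n b t v) := by
    rw [GT_eq_GS_add_LT, GT_eq_GS_add_LT]; ring
  rw [e, Dvec, lAdd, add_div]
  exact (abs_add_le _ _).trans (add_le_add ht (lt1 Mv a ha X₀ kk nn hφ h0 b t v ρ))

include hφ hX hk hν in
/-- **`h1×T` FOR `𝒢` FROM `h1×T` FOR `⊕Γ`** (wrapped shift): constant `D 3 + 2·ellD1 4 a`.
[folklore] -/
theorem h1xT_of_gamma
    (h1xS : ∀ n : ℕ, 2 ≤ n → ∀ b ∈ Bset n, ∀ v, ∀ᶠ t in l,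
      |GS Mv a X₀ kk nn φ n (sh n b) t v - GS Mv a X₀ kk nn φ n b t v| ≤ D 3 / (n : ℝ) ^ 3) :
    ∀ n : ℕ, 2 ≤ n → ∀ b ∈ Bset n, ∀ v, ∀ᶠ t in l,
      |GT Mv a ha X₀ kk nn φ n (sh n b) t v - GT Mv a ha X₀ kk nn φ n b t v|
        ≤ Dvec D a 3 / (n : ℝ) ^ 3 := by
  intro n hn b hb v
  filter_upwards [h1xS n hn b hb v] with t ht
  have h0 : 0 < n := by omega
  have e : GT Mv a ha X₀ kk nn φ n (sh n b) t v - GT Mv a ha X₀ kk nn φ n b t v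
      = (GS Mv a X₀ kk nn φ n (sh n b) t v - GS Mv a X₀ kk nn φ n b t v)
        + (LT Mv a ha X₀ kk nn φ n (sh n b) t v - LT Mv a ha X₀ kk nn φ n b t v) := by
    rw [GT_eq_GS_add_LT, GT_eq_GS_add_LT]; ring
  rw [e, Dvec, lAdd, add_div]
  exact (abs_add_le _ _).trans
    (add_le_add ht (lt1x Mv a ha X₀ kk nn hφ Bset sh hX hk hν h0 hb t v))

include hφ hX hk hν in
/-- **`h2×T` FOR `𝒢` FROM `h2×T` FOR `⊕Γ`** (wrapped shift; `WallVolumeTransfer.h2x_vol`'s torus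
binder): constant `D 2 + ellD2 4 a`. [folklore] -/
theorem h2xT_of_gamma
    (h2xS : ∀ n : ℕ, 2 ≤ n → ∀ b ∈ Bset n, ∀ v, ∀ᶠ t in l,
      |(GS Mv a X₀ kk nn φ n b t (v + BubbleTransfer.unitVec μ + BubbleTransfer.unitVec ν)
            - gT n b t (v + BubbleTransfer.unitVec μ + BubbleTransfer.unitVec ν))
          - (GS Mv a X₀ kk nn φ n b t (v + BubbleTransfer.unitVec μ)
            - gT n b t (v + BubbleTransfer.unitVec μ))
          - ((GS Mv a X₀ kk nn φ n (sh n b) t (v + BubbleTransfer.unitVec ν)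
              - gT n (sh n b) t (v + BubbleTransfer.unitVec ν))
            - (GS Mv a X₀ kk nn φ n (sh n b) t v - gT n (sh n b) t v))| ≤ D 2 / (n : ℝ) ^ 4) :
    ∀ n : ℕ, 2 ≤ n → ∀ b ∈ Bset n, ∀ v, ∀ᶠ t in l,
      |(GT Mv a ha X₀ kk nn φ n b t (v + BubbleTransfer.unitVec μ + BubbleTransfer.unitVec ν)
            - gT n b t (v + BubbleTransfer.unitVec μ + BubbleTransfer.unitVec ν))
          - (GT Mv a ha X₀ kk nn φ n b t (v + BubbleTransfer.unitVec μ)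
            - gT n b t (v + BubbleTransfer.unitVec μ))
          - ((GT Mv a ha X₀ kk nn φ n (sh n b) t (v + BubbleTransfer.unitVec ν)
              - gT n (sh n b) t (v + BubbleTransfer.unitVec ν))
            - (GT Mv a ha X₀ kk nn φ n (sh n b) t v - gT n (sh n b) t v))|
        ≤ Dvec D a 2 / (n : ℝ) ^ 4 := by
  intro n hn b hb v
  filter_upwards [h2xS n hn b hb v] with t ht
  have h0 : 0 < n := by omega
  have e :
      (GT Mv a ha X₀ kk nn φ n b t (v + BubbleTransfer.unitVec μ + BubbleTransfer.unitVec ν)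
            - gT n b t (v + BubbleTransfer.unitVec μ + BubbleTransfer.unitVec ν))
          - (GT Mv a ha X₀ kk nn φ n b t (v + BubbleTransfer.unitVec μ)
            - gT n b t (v + BubbleTransfer.unitVec μ))
          - ((GT Mv a ha X₀ kk nn φ n (sh n b) t (v + BubbleTransfer.unitVec ν)
              - gT n (sh n b) t (v + BubbleTransfer.unitVec ν))
            - (GT Mv a ha X₀ kk nn φ n (sh n b) t v - gT n (sh n b) t v))
      = ((GS Mv a X₀ kk nn φ n b t (v + BubbleTransfer.unitVec μ + BubbleTransfer.unitVec ν)
            - gT n b t (v + BubbleTransfer.unitVec μ + BubbleTransfer.unitVec ν))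
          - (GS Mv a X₀ kk nn φ n b t (v + BubbleTransfer.unitVec μ)
            - gT n b t (v + BubbleTransfer.unitVec μ))
          - ((GS Mv a X₀ kk nn φ n (sh n b) t (v + BubbleTransfer.unitVec ν)
              - gT n (sh n b) t (v + BubbleTransfer.unitVec ν))
            - (GS Mv a X₀ kk nn φ n (sh n b) t v - gT n (sh n b) t v)))
        + (LT Mv a ha X₀ kk nn φ n b t (v + BubbleTransfer.unitVec μ + BubbleTransfer.unitVec ν)
            - LT Mv a ha X₀ kk nn φ n b t (v + BubbleTransfer.unitVec μ)
            - (LT Mv a ha X₀ kk nn φ n (sh n b) t (v + BubbleTransfer.unitVec ν)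
              - LT Mv a ha X₀ kk nn φ n (sh n b) t v)) := by
    simp only [GT_eq_GS_add_LT]; ring
  rw [e, Dvec, lAdd, add_div]
  exact (abs_add_le _ _).trans
    (add_le_add ht (lt2x Mv a ha X₀ kk nn hφ Bset sh hX hk hν h0 hb t v))

include hφ hX hk hν in
/-- **THE FOUR TORUS-SIDE FREE-COMPARISON ROWS OF THE VECTOR ROAD FROM THE `Γ`-PART'S, AT ONCE**
(binder texts of `WallVolumeTransfer` §`Avg`: `h0T`, `h1T`, `h1×T`, `h2×T`; constants `Dvec D a`,
nonnegative if `D` is). [folklore] -/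
theorem hRows_of_gamma
    (h0S : ∀ n : ℕ, 2 ≤ n → ∀ b ∈ Bset n, ∀ v, ∀ᶠ t in l,
      |GS Mv a X₀ kk nn φ n b t v - gT n b t v| ≤ D 0 / (n : ℝ) ^ 2)
    (h1S : ∀ n : ℕ, 2 ≤ n → ∀ b ∈ Bset n, ∀ v (ρ : Fin 4), ∀ᶠ t in l,
      |(GS Mv a X₀ kk nn φ n b t (v + BubbleTransfer.unitVec ρ) - gT n b t (v + BubbleTransfer.unitVec ρ))
          - (GS Mv a X₀ kk nn φ n b t v - gT n b t v)| ≤ D 1 / (n : ℝ) ^ 3)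
    (h1xS : ∀ n : ℕ, 2 ≤ n → ∀ b ∈ Bset n, ∀ v, ∀ᶠ t in l,
      |GS Mv a X₀ kk nn φ n (sh n b) t v - GS Mv a X₀ kk nn φ n b t v| ≤ D 3 / (n : ℝ) ^ 3)
    (h2xS : ∀ n : ℕ, 2 ≤ n → ∀ b ∈ Bset n, ∀ v, ∀ᶠ t in l,
      |(GS Mv a X₀ kk nn φ n b t (v + BubbleTransfer.unitVec μ + BubbleTransfer.unitVec ν)
            - gT n b t (v + BubbleTransfer.unitVec μ + BubbleTransfer.unitVec ν))
          - (GS Mv a X₀ kk nn φ n b t (v + BubbleTransfer.unitVec μ)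
            - gT n b t (v + BubbleTransfer.unitVec μ))
          - ((GS Mv a X₀ kk nn φ n (sh n b) t (v + BubbleTransfer.unitVec ν)
              - gT n (sh n b) t (v + BubbleTransfer.unitVec ν))
            - (GS Mv a X₀ kk nn φ n (sh n b) t v - gT n (sh n b) t v))| ≤ D 2 / (n : ℝ) ^ 4) :
    (∀ n : ℕ, 2 ≤ n → ∀ b ∈ Bset n, ∀ v, ∀ᶠ t in l,
        |GT Mv a ha X₀ kk nn φ n b t v - gT n b t v| ≤ Dvec D a 0 / (n : ℝ) ^ 2)
    ∧ (∀ n : ℕ, 2 ≤ n → ∀ b ∈ Bset n, ∀ v (ρ : Fin 4), ∀ᶠ t in l,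
        |(GT Mv a ha X₀ kk nn φ n b t (v + BubbleTransfer.unitVec ρ)
              - gT n b t (v + BubbleTransfer.unitVec ρ))
            - (GT Mv a ha X₀ kk nn φ n b t v - gT n b t v)| ≤ Dvec D a 1 / (n : ℝ) ^ 3)
    ∧ (∀ n : ℕ, 2 ≤ n → ∀ b ∈ Bset n, ∀ v, ∀ᶠ t in l,
        |GT Mv a ha X₀ kk nn φ n (sh n b) t v - GT Mv a ha X₀ kk nn φ n b t v|
          ≤ Dvec D a 3 / (n : ℝ) ^ 3)
    ∧ (∀ n : ℕ, 2 ≤ n → ∀ b ∈ Bset n, ∀ v, ∀ᶠ t in l,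
        |(GT Mv a ha X₀ kk nn φ n b t (v + BubbleTransfer.unitVec μ + BubbleTransfer.unitVec ν)
              - gT n b t (v + BubbleTransfer.unitVec μ + BubbleTransfer.unitVec ν))
            - (GT Mv a ha X₀ kk nn φ n b t (v + BubbleTransfer.unitVec μ)
              - gT n b t (v + BubbleTransfer.unitVec μ))
            - ((GT Mv a ha X₀ kk nn φ n (sh n b) t (v + BubbleTransfer.unitVec ν)
                - gT n (sh n b) t (v + BubbleTransfer.unitVec ν))
              - (GT Mv a ha X₀ kk nn φ n (sh n b) t v - gT n (sh n b) t v))|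
          ≤ Dvec D a 2 / (n : ℝ) ^ 4) :=
  ⟨h0T_of_gamma Mv a ha X₀ kk nn hφ Bset gT D h0S,
    h1T_of_gamma Mv a ha X₀ kk nn hφ Bset gT D h1S,
    h1xT_of_gamma Mv a ha X₀ kk nn hφ Bset sh hX hk hν D h1xS,
    h2xT_of_gamma Mv a ha X₀ kk nn hφ Bset sh hX hk hν gT D h2xS⟩

end Transport

end

end Literature.MathematicalPhysics.QuantumFieldTheory.Balaban1983to89.Beta.VectorTailsWindow
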